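import Literature.Probability.RandomPlanarGeometry.YangBaxterSAWObservable
import HarnessLib

/-!
# Rhombic complexes and their self-avoiding walks (for the Yang–Baxter transformation)

Topic `Literature/Probability/RandomPlanarGeometry`; first support file for the discharge of the
named fact `Literature.Probability.RandomPlanarGeometry.SAW.YangBaxter.GlazmanManolescu2019_prop42`
(`YangBaxterSAWTwoPoint.lean`): A. Glazman, I. Manolescu, *Self-avoiding walk on `ℤ²` with
Yang–Baxter weights: universality of critical fugacity and 2-point function*, Ann. Inst. Henri
Poincaré Probab. Stat. 56 (2020), arXiv:1708.00395 (`GlazmanManolescu2019`), **Proposition 4.2**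
(p. 11): the boundary two-point function of a strip does not depend on the order of the columns.
Its printed proof leaves the square grid: "For this section only we will consider a slight
generalisation of the model … walks on any rhombic tiling; rather than defining this properly, we
direct the reader to the examples of figures 5 and 6" (§3, p. 9) — a rhombus is added on top of two
columns of the rectangle `Rect_{T,L}(Θ)` and slid down by Yang–Baxter transformations (§4.2).

This file "defines this properly", combinatorially, in the style of the encoding of
`YangBaxterSAW.lean` (a walk = the list of the edges it crosses):

* `Cx F E`: a **rhombic complex** on a type `F` of faces (rhombi) and `E` of edges: every face has
  four sides `W, S, E, N` (`Cx.side`; the `θ`-corners being `N ∩ W` and `S ∩ E`, as in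
  `YangBaxterSAW.lean`), an angle (`Cx.angle`), and the two partial inverse tables `Cx.sideOf`,
  `Cx.commonFace` used by the encoding; `Cx.Lawful` says that these tables are what they should be
  (in particular two distinct edges border at most one common face).
* `Cx.IsWalk K D a z m`: the list of edges `m` is a self-avoiding walk of the domain `D ⊆ F` from
  the edge `a` to the edge `z` — literally the seven clauses of `YBWalk` (§1, Fig. 1 of the paper);
  `Cx.weight` (product of the local weights `localWeight` of eq. (1)), `Cx.wsum` (the finite
  partition sum `G_D(a, z) = Σ_{γ ⊂ D : a → z} w(γ)` of a finite domain, real-valued since the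
  weights of a general tiling may be negative, p. 2).
* `gridCx Θ`: the half-plane grid of `YangBaxterSAW.lean` as a lawful complex; its walks ARE the
  `YBWalk`s (`YBWalk.isWalk_mids`, `YBWalk.ofIsWalk`) with the same weight (`weight_gridCx`), and
  `twoPoint D Θ a z = ENNReal.ofReal (wsum)` for finite `D` and angles in `[π/3, 2π/3]`
  (`twoPoint_eq_ofReal_wsum`).
* `Cx.Emb`: a side- and angle-preserving embedding of the faces of a domain of one lawful complex
  into another transports walks and weights (`Cx.Emb.isWalk_map_iff`, `Cx.Emb.weight_map`,
  `Cx.Emb.wsum_eq`) — used for re-labellings of edges and for comparing a defect tiling with the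
  grid away from the defect.
* The local data of the gluing argument of Corollary 3.2 (p. 9: "first sum over all possible
  configurations outside `H` … then over those inside `H`"): for a finite set of faces `H` with
  interior edges `IntH` and a list `P` of pairs of boundary edges to be joined inside `H`, the
  locally admissible families of interior edge-lists `Cx.LocValid`, their weight `Cx.wLoc` and the
  local partition function `Cx.Zloc H IntH P` (the two sides of the Yang–Baxter equation,
  Proposition 3.1, are such `Zloc`'s).

The gluing theorem itself, the hexagonal Yang–Baxter identities and the column exchange are in the
sequel files.
-/

noncomputable section

open Real
open scoped ENNReal

namespace Literature.Probability.RandomPlanarGeometry.SAW.YangBaxter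

/-! ### Consecutive pairs of a list -/

section Pairs

variable {α β : Type*}

/-- The consecutive pairs `(l₀,l₁), (l₁,l₂), …` of a list (for a walk given by the edges it
crosses: its arcs; `arcsOf` of `YangBaxterSAW.lean` is the case of mid-edges). [folklore] -/
def pairsOf (l : List α) : List (α × α) := l.zip l.tail

/-- `arcsOf` is `pairsOf`. [folklore] -/
theorem arcsOf_eq_pairsOf (l : List MidEdge) : arcsOf l = pairsOf l := rfl

/-- No pairs in the empty list. [folklore] -/
@[simp] theorem pairsOf_nil : pairsOf ([] : List α) = [] := rfl

/-- No pairs in a singleton. [folklore] -/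
@[simp] theorem pairsOf_singleton (a : α) : pairsOf [a] = [] := rfl

/-- The pairs of `a :: b :: l`. [folklore] -/
@[simp] theorem pairsOf_cons_cons (a b : α) (l : List α) :
    pairsOf (a :: b :: l) = (a, b) :: pairsOf (b :: l) := rfl

/-- The pairs of `a :: l` for `l ≠ []`. [folklore] -/
theorem pairsOf_cons_of_ne_nil (a : α) {l : List α} (h : l ≠ []) :
    pairsOf (a :: l) = (a, l.head h) :: pairsOf l := by
  obtain ⟨b, l, rfl⟩ := List.exists_cons_of_ne_nil h
  rfl

/-- The pairs of a concatenation of nonempty lists. [folklore] -/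
theorem pairsOf_append {l₁ l₂ : List α} (h₁ : l₁ ≠ []) (h₂ : l₂ ≠ []) :
    pairsOf (l₁ ++ l₂) = pairsOf l₁ ++ (l₁.getLast h₁, l₂.head h₂) :: pairsOf l₂ := by
  induction l₁ with
  | nil => exact absurd rfl h₁
  | cons a l₁ ih =>
    rcases eq_or_ne l₁ [] with rfl | hl₁
    · simp [pairsOf_cons_of_ne_nil a h₂]
    · rw [List.cons_append, pairsOf_cons_of_ne_nil a (by simp [hl₁]), pairsOf_cons_of_ne_nil a hl₁, ih hl₁,
        List.getLast_cons hl₁]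
      simp [List.head_append_of_ne_nil hl₁]

/-- The pairs of `l ++ [b]` for `l ≠ []`. [folklore] -/
theorem pairsOf_append_singleton {l : List α} (h : l ≠ []) (b : α) :
    pairsOf (l ++ [b]) = pairsOf l ++ [(l.getLast h, b)] := by
  rw [pairsOf_append h (List.cons_ne_nil b [])]; rfl

/-- The pairs of a mapped list. [folklore] -/
theorem pairsOf_map (f : α → β) (l : List α) : pairsOf (l.map f) = (pairsOf l).map (Prod.map f f) := by
  rw [pairsOf, pairsOf, ← List.map_tail, List.zip_map]

/-- The components of a pair are members of the list. [folklore] -/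
theorem mem_of_mem_pairsOf {l : List α} {p : α × α} (hp : p ∈ pairsOf l) : p.1 ∈ l ∧ p.2 ∈ l := by
  obtain ⟨h1, h2⟩ := List.of_mem_zip hp
  exact ⟨h1, List.mem_of_mem_tail h2⟩

/-- Membership in `pairsOf` by index. [folklore] -/
theorem mem_pairsOf_iff {l : List α} {p : α × α} :
    p ∈ pairsOf l ↔ ∃ (i : ℕ) (hi : i + 1 < l.length), p = (l[i], l[i + 1]) := by
  unfold pairsOf
  rw [List.mem_iff_getElem]
  constructor
  · rintro ⟨i, hi, rfl⟩
    simp only [List.length_zip, List.length_tail] at hi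
    exact ⟨i, by omega, by simp [List.getElem_zip, List.getElem_tail]⟩
  · rintro ⟨i, hi, rfl⟩
    exact ⟨i, by simp [List.length_zip]; omega, by simp [List.getElem_zip, List.getElem_tail]⟩

/-- In a list without repetition, two pairs ending, resp. starting, at the same element are
consecutive pairs. [folklore] -/
theorem pairsOf_consecutive_of_nodup {l : List α} (hl : l.Nodup) {p q : α × α} (hp : p ∈ pairsOf l)
    (hq : q ∈ pairsOf l) (h : p.2 = q.1) :
    ∃ (i : ℕ) (hi : i + 2 < l.length), p = (l[i], l[i + 1]) ∧ q = (l[i + 1], l[i + 2]) := by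
  obtain ⟨i, hi, rfl⟩ := mem_pairsOf_iff.1 hp
  obtain ⟨j, hj, rfl⟩ := mem_pairsOf_iff.1 hq
  simp only at h
  have hij : i + 1 = j := (List.Nodup.getElem_inj_iff hl).1 h
  subst hij
  exact ⟨i, hj, rfl, rfl⟩

/-- The pairs of a list without repetition have no repetition. [folklore] -/
theorem nodup_pairsOf {l : List α} (hl : l.Nodup) : (pairsOf l).Nodup := by
  unfold pairsOf
  exact List.Nodup.of_map Prod.snd (by rw [List.map_snd_zip (by simp)]; exact hl.sublist (List.tail_sublist l))

end Pairs

/-- `arcKind` is symmetric. [cite: GlazmanManolescu2019, Fig. 1] -/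
theorem arcKind_comm (s t : Side) : arcKind s t = arcKind t s := by
  cases s <;> cases t <;> rfl

/-! ### Rhombic complexes -/

/-- **A rhombic complex** ("walks on any rhombic tiling", §3): faces `F` (rhombi, each with four
sides labelled `W, S, E, N`, the `θ`-corners being `N ∩ W` and `S ∩ E`, and an angle `θ`), edges
`E`, and the two look-up tables of the encoding: the side of a face an edge lies on, and the common
face of two edges. [cite: GlazmanManolescu2019, §3 (rhombic tilings)] -/
structure Cx (F E : Type*) where
  /-- the edge on side `s` of the face `f` -/
  side : F → Side → E
  /-- which side of `f` the edge `e` lies on (`none` if it is not a side of `f`) -/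
  sideOf : F → E → Option Side
  /-- the common face of two distinct edges (`none` if there is none, or if `e = e'`) -/
  commonFace : E → E → Option F
  /-- the angle of the rhombus `f` -/
  angle : F → ℝ

namespace Cx

variable {F E : Type*} (K : Cx F E)

/-- The face an arc (pair of consecutive crossed edges) is drawn in. [cite: GlazmanManolescu2019, §1] -/
def arcFace (p : E × E) : Option F := K.commonFace p.1 p.2

/-- The kind (`u₁`/`u₂`/`v`-type) of an arc, read from the sides of its face it joins.
[cite: GlazmanManolescu2019, Fig. 1] -/
def arcKindOf (p : E × E) : Option ArcKind :=
  (K.arcFace p).bind fun f =>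
    match K.sideOf f p.1, K.sideOf f p.2 with
    | some s, some t => some (arcKind s t)
    | _, _ => none

/-- **A self-avoiding walk of the complex `K` in the domain `D`, from the edge `a` to the edge `z`**,
given by the list `m` of the edges it crosses: the seven clauses of `YBWalk` ("a simple curve
starting and ending at midpoints of edges, intersecting edges at right angles and traversing each
rhombus in one of the ways depicted in Fig. 1"; "crosses any edge at most once").
[cite: GlazmanManolescu2019, §1 and §3] -/
structure IsWalk (D : Set F) (a z : E) (m : List E) : Prop where
  /-- the walk starts at `a` -/
  head_eq : m.head? = some a
  /-- the walk ends at `z` -/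
  getLast_eq : m.getLast? = some z
  /-- "crosses any edge at most once" -/
  nodup : m.Nodup
  /-- each arc is drawn in a rhombus of the domain -/
  arc_mem : ∀ p ∈ pairsOf m, ∃ f ∈ D, K.arcFace p = some f
  /-- consecutive arcs lie in different rhombi (edges are crossed transversally) -/
  isChain : (pairsOf m).IsChain fun p q => K.arcFace p ≠ K.arcFace q
  /-- no rhombus contains both straight (crossing) arcs -/
  noncross : ∀ f : F,
    ((K.side f .W, K.side f .E) ∈ pairsOf m ∨ (K.side f .E, K.side f .W) ∈ pairsOf m) →
      ¬((K.side f .S, K.side f .N) ∈ pairsOf m ∨ (K.side f .N, K.side f .S) ∈ pairsOf m)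

/-- The set of walks of `D` from `a` to `z`. [cite: GlazmanManolescu2019, §1] -/
def walkSet (D : Set F) (a z : E) : Set (List E) := {m | K.IsWalk D a z m}

open Classical in
/-- The walks of `D` from `a` to `z` as a finite set (`∅` if there are infinitely many — never the
case for a finite domain, `Cx.walkSet_finite`). [folklore] -/
def walkFinset (D : Set F) (a z : E) : Finset (List E) :=
  if h : (K.walkSet D a z).Finite then h.toFinset else ∅

section Weight

variable [DecidableEq F]

/-- The rhombi visited by (containing an arc of) the edge list `m`. [folklore] -/
def facesOf (m : List E) : Finset F := ((pairsOf m).filterMap K.arcFace).toFinset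

/-- The kinds of the arcs of `m` inside the rhombus `f`, in order. [cite: GlazmanManolescu2019, Fig. 1] -/
def kindsIn (m : List E) (f : F) : List ArcKind :=
  (pairsOf m).filterMap fun p => if K.arcFace p = some f then K.arcKindOf p else none

/-- **The weight of a walk**: "the product of weights associated to each rhombus" (eq. (1); for a
general tiling some of them may be negative, p. 2). [cite: GlazmanManolescu2019, §1 and §3] -/
def weight (m : List E) : ℝ := ∏ f ∈ K.facesOf m, localWeight (K.angle f) (K.kindsIn m f)

/-- **The partition function `G_D(a, z) = Σ_{γ ⊂ D : a → z} w(γ)`** of a finite domain of a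
rhombic complex (real-valued). [cite: GlazmanManolescu2019, §3, Corollary 3.2 and §4.2 (G_D(a,b))] -/
def wsum (D : Set F) (a z : E) : ℝ := ∑ m ∈ K.walkFinset D a z, K.weight m

end Weight

/-- **Lawful complexes**: the look-up tables are the partial inverses of `side`; in particular two
distinct edges border at most one common face and the four sides of a face are distinct edges
(true in any rhombic tiling of a simply connected planar domain). [folklore] -/
structure Lawful : Prop where
  /-- `sideOf f` is the partial inverse of `side f` -/
  sideOf_eq_some_iff : ∀ (f : F) (e : E) (s : Side), K.sideOf f e = some s ↔ K.side f s = e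
  /-- `commonFace e e'` is THE face of which the distinct edges `e, e'` are both sides -/
  commonFace_eq_some_iff : ∀ (e e' : E) (f : F),
    K.commonFace e e' = some f ↔ e ≠ e' ∧ (∃ s, K.side f s = e) ∧ ∃ t, K.side f t = e'

namespace Lawful

variable {K}

/-- `sideOf` recovers the side. [folklore] -/
theorem sideOf_side (hK : K.Lawful) (f : F) (s : Side) : K.sideOf f (K.side f s) = some s :=
  (hK.sideOf_eq_some_iff f _ s).2 rfl

/-- The four sides of a face are distinct edges. [folklore] -/
theorem side_injective (hK : K.Lawful) (f : F) : Function.Injective (K.side f) := fun s t h => by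
  have := hK.sideOf_side f s
  rw [h, hK.sideOf_side] at this
  exact (Option.some_injective _ this).symm

/-- `commonFace` is symmetric. [folklore] -/
theorem commonFace_comm (hK : K.Lawful) (e e' : E) : K.commonFace e e' = K.commonFace e' e := by
  rcases h : K.commonFace e' e with _ | f
  · by_contra h'
    obtain ⟨g, hg⟩ := Option.ne_none_iff_exists'.1 h'
    obtain ⟨hne, hs, ht⟩ := (hK.commonFace_eq_some_iff e e' g).1 hg
    rw [(hK.commonFace_eq_some_iff e' e g).2 ⟨hne.symm, ht, hs⟩] at h
    cases h
  · obtain ⟨hne, hs, ht⟩ := (hK.commonFace_eq_some_iff e' e f).1 h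
    exact (hK.commonFace_eq_some_iff e e' f).2 ⟨hne.symm, ht, hs⟩

/-- `arcFace` is symmetric. [folklore] -/
theorem arcFace_swap (hK : K.Lawful) (p : E × E) : K.arcFace p.swap = K.arcFace p :=
  hK.commonFace_comm p.2 p.1

/-- `arcKindOf` is symmetric. [folklore] -/
theorem arcKindOf_swap (hK : K.Lawful) (p : E × E) : K.arcKindOf p.swap = K.arcKindOf p := by
  unfold arcKindOf
  rw [hK.arcFace_swap]
  rcases K.arcFace p with _ | f
  · rfl
  · simp only [Option.bind_some, Prod.fst_swap, Prod.snd_swap]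
    rcases K.sideOf f p.1 with _ | s <;> rcases K.sideOf f p.2 with _ | t <;> simp [arcKind_comm]

/-- The sides an arc joins. [folklore] -/
theorem exists_sides_of_arcFace (hK : K.Lawful) {p : E × E} {f : F} (h : K.arcFace p = some f) :
    ∃ s t : Side, s ≠ t ∧ K.side f s = p.1 ∧ K.side f t = p.2 ∧ K.arcKindOf p = some (arcKind s t) := by
  obtain ⟨hne, ⟨s, hs⟩, ⟨t, ht⟩⟩ := (hK.commonFace_eq_some_iff _ _ f).1 h
  refine ⟨s, t, fun hst => hne (by rw [← hs, ← ht, hst]), hs, ht, ?_⟩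
  unfold arcKindOf
  rw [h, Option.bind_some, ← hs, ← ht, hK.sideOf_side, hK.sideOf_side]

/-- A face of which both components of an arc are sides is the face of the arc. [folklore] -/
theorem eq_of_arcFace_of_sides (hK : K.Lawful) {p : E × E} {f g : F} (h : K.arcFace p = some f)
    {s t : Side} (hs : K.side g s = p.1) (ht : K.side g t = p.2) : g = f := by
  obtain ⟨hne, -, -⟩ := (hK.commonFace_eq_some_iff _ _ f).1 h
  have : K.arcFace p = some g := (hK.commonFace_eq_some_iff _ _ g).2 ⟨hne, ⟨s, hs⟩, ⟨t, ht⟩⟩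
  rw [h] at this
  exact (Option.some_injective _ this).symm

/-- The arc joining two distinct sides of a face lies in that face. [folklore] -/
theorem arcFace_side_side (hK : K.Lawful) (f : F) {s t : Side} (hst : s ≠ t) :
    K.arcFace (K.side f s, K.side f t) = some f :=
  (hK.commonFace_eq_some_iff _ _ f).2 ⟨fun h => hst (hK.side_injective f h), ⟨s, rfl⟩, ⟨t, rfl⟩⟩

end Lawful

/-! ### Walks: first consequences -/

namespace IsWalk

variable {K} {D : Set F} {a z : E} {m : List E}

/-- A walk crosses at least one edge. [folklore] -/
theorem ne_nil (h : K.IsWalk D a z m) : m ≠ [] := by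
  rintro rfl; simpa using h.head_eq

/-- The walk crosses its starting edge. [folklore] -/
theorem start_mem (h : K.IsWalk D a z m) : a ∈ m := List.mem_of_mem_head? h.head_eq

/-- The walk crosses its final edge. [folklore] -/
theorem end_mem (h : K.IsWalk D a z m) : z ∈ m := List.mem_of_getLast? h.getLast_eq

/-- Every crossed edge other than the first is a side of a visited face of the domain. [folklore] -/
theorem mem_cases (hK : K.Lawful) (h : K.IsWalk D a z m) {e : E} (he : e ∈ m) :
    e = a ∨ ∃ f ∈ D, ∃ s, K.side f s = e := by
  obtain ⟨i, hi, rfl⟩ := List.getElem_of_mem he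
  rcases Nat.eq_zero_or_pos i with rfl | hi0
  · left
    have := h.head_eq
    rw [List.head?_eq_getElem?, List.getElem?_eq_getElem hi] at this
    exact Option.some_injective _ this
  · right
    obtain ⟨j, rfl⟩ : ∃ j, i = j + 1 := ⟨i - 1, by omega⟩
    obtain ⟨f, hfD, hf⟩ := h.arc_mem _ (mem_pairsOf_iff.2 ⟨j, hi, rfl⟩)
    obtain ⟨s, t, -, -, ht, -⟩ := hK.exists_sides_of_arcFace hf
    exact ⟨f, hfD, t, ht⟩

/-- Enlarging the domain. [folklore] -/
theorem mono {D' : Set F} (h : K.IsWalk D a z m) (hD : D ⊆ D') : K.IsWalk D' a z m where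
  head_eq := h.head_eq
  getLast_eq := h.getLast_eq
  nodup := h.nodup
  arc_mem p hp := let ⟨f, hf, hpf⟩ := h.arc_mem p hp; ⟨f, hD hf, hpf⟩
  isChain := h.isChain
  noncross := h.noncross

/-- Restricting the domain to the faces actually allowed: a walk of `D` whose arcs avoid the faces
of `R` is a walk of `D \ R`. [folklore] -/
theorem of_forall_not_mem {R : Set F} (h : K.IsWalk D a z m)
    (hR : ∀ p ∈ pairsOf m, ∀ f ∈ R, K.arcFace p ≠ some f) : K.IsWalk (D \ R) a z m where
  head_eq := h.head_eq
  getLast_eq := h.getLast_eq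
  nodup := h.nodup
  arc_mem p hp := let ⟨f, hf, hpf⟩ := h.arc_mem p hp; ⟨f, ⟨hf, fun hfR => hR p hp f hfR hpf⟩, hpf⟩
  isChain := h.isChain
  noncross := h.noncross

/-- The only walk from `a` to `a` is the empty one. [cite: GlazmanManolescu2019, §2.1 ("the empty configuration")] -/
theorem eq_singleton_of_self (h : K.IsWalk D a a m) : m = [a] := by
  have hnd := h.nodup
  have h1 := h.head_eq
  have h2 := h.getLast_eq
  match m, h1, h2, hnd with
  | [x], h1, _, _ => simpa using h1
  | x :: y :: l, h1, h2, hnd =>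
    exfalso
    simp only [List.head?_cons, Option.some.injEq] at h1
    subst h1
    rw [List.getLast?_eq_some_getLast (by simp)] at h2
    simp only [Option.some.injEq] at h2
    have hmem : (x :: y :: l).getLast (by simp) ∈ y :: l := by
      rw [List.getLast_cons (by simp)]
      exact List.getLast_mem _
    rw [h2] at hmem
    exact (List.nodup_cons.1 hnd).1 hmem

/-- The empty walk. [cite: GlazmanManolescu2019, §2.1] -/
theorem singleton (a : E) : K.IsWalk D a a [a] where
  head_eq := rfl
  getLast_eq := rfl
  nodup := List.nodup_singleton a
  arc_mem p hp := by simp at hp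
  isChain := by simp
  noncross f h := by simp at h

end IsWalk

/-- The walks from `a` to `a`: only `[a]`. [cite: GlazmanManolescu2019, §2.1] -/
theorem walkSet_self (D : Set F) (a : E) : K.walkSet D a a = {[a]} :=
  Set.ext fun _ => ⟨fun h => IsWalk.eq_singleton_of_self h, fun h => h ▸ IsWalk.singleton a⟩

/-! ### Finiteness of the set of walks of a finite domain -/

/-- Lists of bounded length with entries in a finite set form a finite set (a private copy of
`Literature.Probability.Percolation.finite_setOf_length_le`, to keep the imports within the topic). [folklore] -/
private theorem finite_setOf_length_le_of_finite {α : Type*} {S : Set α} (hS : S.Finite) (N : ℕ) :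
    {l : List α | l.length ≤ N ∧ ∀ x ∈ l, x ∈ S}.Finite := by
  induction N with
  | zero =>
    refine (Set.finite_singleton ([] : List α)).subset ?_
    rintro l ⟨hl, -⟩
    exact List.eq_nil_of_length_eq_zero (Nat.le_zero.1 hl)
  | succ N ih =>
    have hsub : {l : List α | l.length ≤ N + 1 ∧ ∀ x ∈ l, x ∈ S} ⊆
        {[]} ∪ ⋃ a ∈ S, (fun l => a :: l) '' {l : List α | l.length ≤ N ∧ ∀ x ∈ l, x ∈ S} := by
      rintro l ⟨hl, hmem⟩
      cases l with
      | nil => exact Or.inl rfl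
      | cons a l =>
        refine Or.inr (Set.mem_biUnion (hmem a (by simp)) ⟨l, ⟨?_, fun x hx => hmem x (by simp [hx])⟩, rfl⟩)
        simpa using hl
    exact ((Set.finite_singleton _).union (hS.biUnion fun a _ => (ih.image _))).subset hsub

/-- Lists without repetition with entries in a finite set form a finite set (a private copy of
`Literature.Probability.Percolation.finite_setOf_nodup_subset`). [folklore] -/
private theorem finite_setOf_nodup_of_finite {α : Type*} {S : Set α} (hS : S.Finite) :
    {l : List α | l.Nodup ∧ ∀ x ∈ l, x ∈ S}.Finite := by
  classical
  refine (finite_setOf_length_le_of_finite hS hS.toFinset.card).subset ?_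
  rintro l ⟨hnd, hmem⟩
  refine ⟨?_, hmem⟩
  rw [← List.toFinset_card_of_nodup hnd]
  exact Finset.card_le_card fun x hx => hS.mem_toFinset.2 (hmem x (List.mem_toFinset.1 hx))

/-- The edges available to the walks of `D` from `a`. [folklore] -/
def edgesOf (D : Set F) (a : E) : Set E := {a} ∪ ⋃ f ∈ D, Set.range (K.side f)

/-- Finitely many edges are available in a finite domain. [folklore] -/
theorem edgesOf_finite {D : Set F} (hD : D.Finite) (a : E) : (K.edgesOf D a).Finite :=
  (Set.finite_singleton a).union (hD.biUnion fun _ _ => Set.finite_range _)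

/-- **The walks of a finite domain form a finite set.** [cite: GlazmanManolescu2019, §2.1 ("a finite region")] -/
theorem walkSet_finite (hK : K.Lawful) {D : Set F} (hD : D.Finite) (a z : E) : (K.walkSet D a z).Finite := by
  refine (finite_setOf_nodup_of_finite (K.edgesOf_finite hD a)).subset fun m hm => ⟨hm.nodup, fun e he => ?_⟩
  rcases hm.mem_cases hK he with rfl | ⟨f, hfD, s, rfl⟩
  · exact Or.inl rfl
  · exact Or.inr (Set.mem_biUnion hfD ⟨s, rfl⟩)

/-- Membership in `walkFinset`. [folklore] -/
theorem mem_walkFinset {D : Set F} {a z : E} (h : (K.walkSet D a z).Finite) {m : List E} :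
    m ∈ K.walkFinset D a z ↔ K.IsWalk D a z m := by
  rw [walkFinset, dif_pos h, Set.Finite.mem_toFinset]; rfl

section Weight

variable [DecidableEq F]

/-- `G_D(a, a) = 1`: only the empty walk. [cite: GlazmanManolescu2019, §2.1] -/
theorem wsum_self (D : Set F) (a : E) : K.wsum D a a = 1 := by
  have hfin : (K.walkSet D a a).Finite := by rw [walkSet_self]; exact Set.finite_singleton _
  have : K.walkFinset D a a = {[a]} := by
    ext m; rw [K.mem_walkFinset hfin, Finset.mem_singleton]
    exact ⟨fun h => h.eq_singleton_of_self, fun h => h ▸ IsWalk.singleton a⟩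
  rw [wsum, this, Finset.sum_singleton, weight, facesOf]
  simp

/-- Splitting `G_D` according to whether a given face `r` is visited: the walks avoiding `r` are the
walks of `D \ {r}`. [cite: GlazmanManolescu2019, §4.2 ("G_{D_0}(a,b) − G_{Rect}(a,b) = Σ_{γ uses r} w(γ)")] -/
theorem wsum_eq_wsum_diff_add (hK : K.Lawful) {D : Set F} (hD : D.Finite) (r : F) (a z : E) :
    K.wsum D a z = K.wsum (D \ {r}) a z +
      ∑ m ∈ (K.walkFinset D a z).filter (fun m => r ∈ K.facesOf m), K.weight m := by
  have hfin := K.walkSet_finite hK hD a z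
  have hfin' := K.walkSet_finite hK (hD.subset Set.sdiff_subset : (D \ {r}).Finite) a z
  rw [wsum, wsum, ← Finset.sum_filter_add_sum_filter_not _ (fun m => r ∈ K.facesOf m), add_comm]
  congr 1
  refine Finset.sum_congr (Finset.ext fun m => ?_) fun _ _ => rfl
  rw [Finset.mem_filter, K.mem_walkFinset hfin, K.mem_walkFinset hfin']
  constructor
  · rintro ⟨hm, hr⟩
    refine hm.of_forall_not_mem fun p hp f hf hpf => hr ?_
    rw [Set.mem_singleton_iff] at hf
    subst hf
    exact List.mem_toFinset.2 (List.mem_filterMap.2 ⟨p, hp, hpf⟩)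
  · intro hm
    refine ⟨hm.mono Set.sdiff_subset, fun hr => ?_⟩
    obtain ⟨p, hp, hpf⟩ := List.mem_filterMap.1 (List.mem_toFinset.1 hr)
    obtain ⟨f, hf, hpf'⟩ := hm.arc_mem p hp
    rw [hpf] at hpf'
    cases hpf'
    exact hf.2 rfl

end Weight

end Cx

namespace Cx

/-! ### Transport of walks along embeddings -/

section Emb

variable {F₁ E₁ F₂ E₂ : Type*}

/-- Pointwise-on-members congruence for `filterMap`. [folklore] -/
theorem filterMap_congr_of_mem {α β : Type*} {f g : α → Option β} {l : List α}
    (h : ∀ x ∈ l, f x = g x) : l.filterMap f = l.filterMap g := by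
  induction l with
  | nil => rfl
  | cons x l ih =>
    rw [List.filterMap_cons, List.filterMap_cons, h x (by simp), ih fun y hy => h y (by simp [hy])]

/-- Mapping a chain along a function that is relation-preserving on members. [folklore] -/
theorem isChain_map_of_mem {α β : Type*} {R : α → α → Prop} {S : β → β → Prop} (f : α → β)
    {l : List α} (h : l.IsChain R) (himp : ∀ x ∈ l, ∀ y ∈ l, R x y → S (f x) (f y)) :
    (l.map f).IsChain S := by
  induction l with
  | nil => exact .nil
  | cons x l ih =>
    cases l with
    | nil => exact .singleton _
    | cons y l =>
      rw [List.map_cons, List.map_cons, List.isChain_cons_cons]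
      rw [List.isChain_cons_cons] at h
      exact ⟨himp x (by simp) y (by simp) h.1,
        by simpa using ih h.2 fun u hu v hv huv => himp u (by simp [hu]) v (by simp [hv]) huv⟩

/-- **An embedding of the domain `D₁` of the complex `K₁` into the complex `K₂`**: a map of faces,
injective on `D₁`, and an injective map of edges, commuting with `side` and `angle` on the faces of
`D₁` (e.g. a re-labelling of edges, or the identity from a sub-tiling to a tiling containing it).
[folklore] -/
structure Emb (K₁ : Cx F₁ E₁) (K₂ : Cx F₂ E₂) (D₁ : Set F₁) where
  /-- the map of faces -/
  φF : F₁ → F₂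
  /-- the map of edges -/
  φE : E₁ → E₂
  /-- edges are mapped injectively -/
  injE : Function.Injective φE
  /-- faces of the domain are mapped injectively -/
  injF : Set.InjOn φF D₁
  /-- sides are preserved on the domain -/
  side_eq : ∀ f ∈ D₁, ∀ s, K₂.side (φF f) s = φE (K₁.side f s)
  /-- angles are preserved on the domain -/
  angle_eq : ∀ f ∈ D₁, K₂.angle (φF f) = K₁.angle f

namespace Emb

variable {K₁ : Cx F₁ E₁} {K₂ : Cx F₂ E₂} {D₁ : Set F₁} (ι : Emb K₁ K₂ D₁)

/-- The face of a mapped arc. [folklore] -/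
theorem arcFace_map_eq_some_iff (h₁ : K₁.Lawful) (h₂ : K₂.Lawful) (p : E₁ × E₁) {f : F₁} (hf : f ∈ D₁) :
    K₂.arcFace (Prod.map ι.φE ι.φE p) = some (ι.φF f) ↔ K₁.arcFace p = some f := by
  rw [arcFace, arcFace, h₂.commonFace_eq_some_iff, h₁.commonFace_eq_some_iff]
  simp only [Prod.map_fst, Prod.map_snd, ι.injE.ne_iff, ι.side_eq f hf, ι.injE.eq_iff]

/-- The face of a mapped arc of the domain. [folklore] -/
theorem arcFace_map_of_mem (h₁ : K₁.Lawful) (h₂ : K₂.Lawful) {p : E₁ × E₁} {f : F₁} (hf : f ∈ D₁)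
    (hp : K₁.arcFace p = some f) : K₂.arcFace (Prod.map ι.φE ι.φE p) = some (ι.φF f) :=
  (ι.arcFace_map_eq_some_iff h₁ h₂ p hf).2 hp

/-- A mapped arc drawn in a face of the image domain comes from an arc drawn in the domain. [folklore] -/
theorem arcFace_eq_some_of_map (h₁ : K₁.Lawful) (h₂ : K₂.Lawful) {p : E₁ × E₁} {f₂ : F₂}
    (hf₂ : f₂ ∈ ι.φF '' D₁) (hp : K₂.arcFace (Prod.map ι.φE ι.φE p) = some f₂) :
    ∃ f ∈ D₁, ι.φF f = f₂ ∧ K₁.arcFace p = some f := by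
  obtain ⟨f, hf, rfl⟩ := hf₂
  exact ⟨f, hf, rfl, (ι.arcFace_map_eq_some_iff h₁ h₂ p hf).1 hp⟩

/-- `sideOf` is preserved on the domain. [folklore] -/
theorem sideOf_map (h₁ : K₁.Lawful) (h₂ : K₂.Lawful) {f : F₁} (hf : f ∈ D₁) (e : E₁) :
    K₂.sideOf (ι.φF f) (ι.φE e) = K₁.sideOf f e := by
  ext s
  rw [h₂.sideOf_eq_some_iff, h₁.sideOf_eq_some_iff, ι.side_eq f hf, ι.injE.eq_iff]

/-- The kind of a mapped arc of the domain. [folklore] -/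
theorem arcKindOf_map (h₁ : K₁.Lawful) (h₂ : K₂.Lawful) {p : E₁ × E₁} {f : F₁} (hf : f ∈ D₁)
    (hp : K₁.arcFace p = some f) : K₂.arcKindOf (Prod.map ι.φE ι.φE p) = K₁.arcKindOf p := by
  unfold arcKindOf
  rw [ι.arcFace_map_of_mem h₁ h₂ hf hp, hp, Option.bind_some, Option.bind_some, Prod.map_fst, Prod.map_snd,
    ι.sideOf_map h₁ h₂ hf, ι.sideOf_map h₁ h₂ hf]

variable {a z : E₁} {m : List E₁}

/-- **Transport of walks**: the image of a walk of `D₁` is a walk of the image domain. [folklore] -/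
theorem isWalk_map (h₁ : K₁.Lawful) (h₂ : K₂.Lawful) (hm : K₁.IsWalk D₁ a z m) :
    K₂.IsWalk (ι.φF '' D₁) (ι.φE a) (ι.φE z) (m.map ι.φE) where
  head_eq := by rw [List.head?_map, hm.head_eq]; rfl
  getLast_eq := by rw [List.getLast?_map, hm.getLast_eq]; rfl
  nodup := hm.nodup.map ι.injE
  arc_mem p hp := by
    rw [pairsOf_map, List.mem_map] at hp
    obtain ⟨q, hq, rfl⟩ := hp
    obtain ⟨f, hf, hqf⟩ := hm.arc_mem q hq
    exact ⟨ι.φF f, ⟨f, hf, rfl⟩, ι.arcFace_map_of_mem h₁ h₂ hf hqf⟩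
  isChain := by
    rw [pairsOf_map]
    refine isChain_map_of_mem _ hm.isChain fun p hp q hq hpq => ?_
    obtain ⟨f, hf, hpf⟩ := hm.arc_mem p hp
    obtain ⟨g, hg, hqg⟩ := hm.arc_mem q hq
    rw [ι.arcFace_map_of_mem h₁ h₂ hf hpf, ι.arcFace_map_of_mem h₁ h₂ hg hqg]
    rw [hpf, hqg] at hpq
    exact fun h => hpq (by rw [ι.injF hf hg (Option.some_injective _ h)])
  noncross f₂ hWE hSN := by
    -- the face `f₂` is the image of a face of the domain carrying the same arcs
    have key : ∀ s t : Side, (K₂.side f₂ s, K₂.side f₂ t) ∈ pairsOf (m.map ι.φE) →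
        ∃ f ∈ D₁, ι.φF f = f₂ ∧ (K₁.side f s, K₁.side f t) ∈ pairsOf m := by
      intro s t hst
      rw [pairsOf_map, List.mem_map] at hst
      obtain ⟨q, hq, hq'⟩ := hst
      obtain ⟨f, hf, hqf⟩ := hm.arc_mem q hq
      have h2 := ι.arcFace_map_of_mem h₁ h₂ hf hqf
      rw [hq'] at h2
      have hf₂ : f₂ = ι.φF f := h₂.eq_of_arcFace_of_sides h2 (s := s) (t := t) rfl rfl
      subst hf₂
      refine ⟨f, hf, rfl, ?_⟩
      rw [ι.side_eq f hf, ι.side_eq f hf] at hq'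
      have hq1 : q = (K₁.side f s, K₁.side f t) := by
        obtain ⟨q1, q2⟩ := q
        simp only [Prod.map, Prod.mk.injEq] at hq'
        rw [ι.injE hq'.1, ι.injE hq'.2]
      exact hq1 ▸ hq
    have key' : ∀ s t s' t' : Side, (K₂.side f₂ s, K₂.side f₂ t) ∈ pairsOf (m.map ι.φE) →
        (K₂.side f₂ s', K₂.side f₂ t') ∈ pairsOf (m.map ι.φE) →
        ∃ f ∈ D₁, (K₁.side f s, K₁.side f t) ∈ pairsOf m ∧ (K₁.side f s', K₁.side f t') ∈ pairsOf m := by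
      intro s t s' t' hst hst'
      obtain ⟨f, hf, hff, h⟩ := key s t hst
      obtain ⟨f', hf', hff', h'⟩ := key s' t' hst'
      obtain rfl : f = f' := ι.injF hf hf' (hff.trans hff'.symm)
      exact ⟨f, hf, h, h'⟩
    rcases hWE with hWE | hWE <;> rcases hSN with hSN | hSN
    · obtain ⟨f, -, h, h'⟩ := key' _ _ _ _ hWE hSN
      exact hm.noncross f (Or.inl h) (Or.inl h')
    · obtain ⟨f, -, h, h'⟩ := key' _ _ _ _ hWE hSN
      exact hm.noncross f (Or.inl h) (Or.inr h')
    · obtain ⟨f, -, h, h'⟩ := key' _ _ _ _ hWE hSN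
      exact hm.noncross f (Or.inr h) (Or.inl h')
    · obtain ⟨f, -, h, h'⟩ := key' _ _ _ _ hWE hSN
      exact hm.noncross f (Or.inr h) (Or.inr h')

/-- **Transport of walks, converse**: if the image of an edge list is a walk of the image domain,
the list is a walk of the domain. [folklore] -/
theorem isWalk_of_map (h₁ : K₁.Lawful) (h₂ : K₂.Lawful)
    (hm : K₂.IsWalk (ι.φF '' D₁) (ι.φE a) (ι.φE z) (m.map ι.φE)) : K₁.IsWalk D₁ a z m := by
  have harc : ∀ p ∈ pairsOf m, ∃ f ∈ D₁, K₁.arcFace p = some f := by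
    intro p hp
    obtain ⟨f₂, hf₂, hpf⟩ := hm.arc_mem (Prod.map ι.φE ι.φE p)
      (by rw [pairsOf_map]; exact List.mem_map_of_mem hp)
    obtain ⟨f, hf, -, hpf'⟩ := ι.arcFace_eq_some_of_map h₁ h₂ hf₂ hpf
    exact ⟨f, hf, hpf'⟩
  refine ⟨?_, ?_, hm.nodup.of_map _, harc, ?_, ?_⟩
  · have := hm.head_eq
    rw [List.head?_map, Option.map_eq_some_iff] at this
    obtain ⟨e, he, hea⟩ := this
    rw [he, ι.injE hea]
  · have := hm.getLast_eq
    rw [List.getLast?_map, Option.map_eq_some_iff] at this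
    obtain ⟨e, he, hez⟩ := this
    rw [he, ι.injE hez]
  · have hc := hm.isChain
    rw [pairsOf_map, List.isChain_map] at hc
    have := isChain_map_of_mem (S := fun p q => K₁.arcFace p ≠ K₁.arcFace q) id hc
      fun p hp q hq hpq heq => hpq (by
        obtain ⟨f, hf, hpf⟩ := harc p hp
        obtain ⟨g, hg, hqg⟩ := harc q hq
        simp only [id] at heq
        rw [ι.arcFace_map_of_mem h₁ h₂ hf hpf, ι.arcFace_map_of_mem h₁ h₂ hg hqg]
        rw [hpf, hqg] at heq
        rw [Option.some_injective _ heq])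
    simpa using this
  · intro f hWE hSN
    -- `f` carries an arc of `m`, hence is a face of the domain
    have hfD : f ∈ D₁ := by
      rcases hWE with h | h
      · obtain ⟨g, hg, hpg⟩ := harc _ h
        rwa [h₁.eq_of_arcFace_of_sides hpg (s := .W) (t := .E) rfl rfl]
      · obtain ⟨g, hg, hpg⟩ := harc _ h
        rwa [h₁.eq_of_arcFace_of_sides hpg (s := .E) (t := .W) rfl rfl]
    have tr : ∀ s t : Side, (K₁.side f s, K₁.side f t) ∈ pairsOf m →
        (K₂.side (ι.φF f) s, K₂.side (ι.φF f) t) ∈ pairsOf (m.map ι.φE) := by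
      intro s t h
      rw [ι.side_eq f hfD, ι.side_eq f hfD, pairsOf_map]
      exact List.mem_map_of_mem (f := Prod.map ι.φE ι.φE) h
    exact hm.noncross (ι.φF f) (hWE.imp (tr _ _) (tr _ _)) (hSN.imp (tr _ _) (tr _ _))

/-- A walk of the image domain from the image of `a` only crosses image edges. [folklore] -/
theorem mem_range_of_isWalk (h₂ : K₂.Lawful) {m₂ : List E₂} {z₂ : E₂}
    (hm : K₂.IsWalk (ι.φF '' D₁) (ι.φE a) z₂ m₂) {e : E₂} (he : e ∈ m₂) : e ∈ Set.range ι.φE := by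
  rcases hm.mem_cases h₂ he with rfl | ⟨f₂, ⟨f, hf, rfl⟩, s, rfl⟩
  · exact ⟨a, rfl⟩
  · exact ⟨K₁.side f s, (ι.side_eq f hf s).symm⟩

/-- A walk of the image domain between image edges is the image of an edge list. [folklore] -/
theorem exists_eq_map_of_isWalk (h₂ : K₂.Lawful) {m₂ : List E₂}
    (hm : K₂.IsWalk (ι.φF '' D₁) (ι.φE a) (ι.φE z) m₂) : ∃ m : List E₁, m₂ = m.map ι.φE := by
  classical
  haveI : Nonempty E₁ := ⟨a⟩
  refine ⟨m₂.map (Function.invFun ι.φE), ?_⟩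
  rw [List.map_map, eq_comm]
  conv_rhs => rw [← List.map_id m₂]
  refine List.map_congr_left fun e he => ?_
  exact Function.invFun_eq (ι.mem_range_of_isWalk h₂ hm he)

/-- **Transport of walks, as an equivalence of the two conditions.** [folklore] -/
theorem isWalk_map_iff (h₁ : K₁.Lawful) (h₂ : K₂.Lawful) :
    K₂.IsWalk (ι.φF '' D₁) (ι.φE a) (ι.φE z) (m.map ι.φE) ↔ K₁.IsWalk D₁ a z m :=
  ⟨ι.isWalk_of_map h₁ h₂, ι.isWalk_map h₁ h₂⟩

/-- The walks of the image domain are the images of the walks of the domain. [folklore] -/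
theorem walkFinset_eq_image [DecidableEq E₂] (h₁ : K₁.Lawful) (h₂ : K₂.Lawful) (hD : D₁.Finite) (a z : E₁) :
    K₂.walkFinset (ι.φF '' D₁) (ι.φE a) (ι.φE z) = (K₁.walkFinset D₁ a z).image (List.map ι.φE) := by
  ext m₂
  rw [K₂.mem_walkFinset (K₂.walkSet_finite h₂ (hD.image _) _ _), Finset.mem_image]
  constructor
  · intro hm
    obtain ⟨m, rfl⟩ := ι.exists_eq_map_of_isWalk h₂ hm
    exact ⟨m, (K₁.mem_walkFinset (K₁.walkSet_finite h₁ hD _ _)).2 (ι.isWalk_of_map h₁ h₂ hm), rfl⟩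
  · rintro ⟨m, hm, rfl⟩
    exact ι.isWalk_map h₁ h₂ ((K₁.mem_walkFinset (K₁.walkSet_finite h₁ hD _ _)).1 hm)

variable [DecidableEq F₁] [DecidableEq F₂]

/-- The faces visited by the image walk. [folklore] -/
theorem facesOf_map (h₁ : K₁.Lawful) (h₂ : K₂.Lawful) (hm : K₁.IsWalk D₁ a z m) :
    K₂.facesOf (m.map ι.φE) = (K₁.facesOf m).image ι.φF := by
  ext f₂
  simp only [facesOf, List.mem_toFinset, List.mem_filterMap, Finset.mem_image, pairsOf_map, List.mem_map]
  constructor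
  · rintro ⟨p', ⟨p, hp, rfl⟩, hpf⟩
    obtain ⟨f, hf, hpf1⟩ := hm.arc_mem p hp
    rw [ι.arcFace_map_of_mem h₁ h₂ hf hpf1] at hpf
    cases hpf
    exact ⟨f, ⟨p, hp, hpf1⟩, rfl⟩
  · rintro ⟨f, ⟨p, hp, hpf⟩, rfl⟩
    obtain ⟨g, hg, hpg⟩ := hm.arc_mem p hp
    rw [hpg] at hpf
    cases hpf
    exact ⟨_, ⟨p, hp, rfl⟩, ι.arcFace_map_of_mem h₁ h₂ hg hpg⟩

/-- The faces visited by a walk are faces of the domain. [folklore] -/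
theorem _root_.Literature.Probability.RandomPlanarGeometry.SAW.YangBaxter.Cx.IsWalk.facesOf_subset
    {F E : Type*} [DecidableEq F] {K : Cx F E} {D : Set F} {a z : E} {m : List E}
    (hm : K.IsWalk D a z m) : ↑(K.facesOf m) ⊆ D := by
  intro f hf
  obtain ⟨p, hp, hpf⟩ := List.mem_filterMap.1 (List.mem_toFinset.1 hf)
  obtain ⟨g, hg, hpg⟩ := hm.arc_mem p hp
  rw [hpg] at hpf
  cases hpf
  exact hg

/-- The kinds of arcs in a face of the domain are preserved. [folklore] -/
theorem kindsIn_map (h₁ : K₁.Lawful) (h₂ : K₂.Lawful) (hm : K₁.IsWalk D₁ a z m) {f : F₁} (hf : f ∈ D₁) :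
    K₂.kindsIn (m.map ι.φE) (ι.φF f) = K₁.kindsIn m f := by
  unfold kindsIn
  rw [pairsOf_map, List.filterMap_map]
  refine filterMap_congr_of_mem fun p hp => ?_
  obtain ⟨g, hg, hpg⟩ := hm.arc_mem p hp
  rw [Function.comp_apply, ι.arcFace_map_of_mem h₁ h₂ hg hpg, hpg]
  by_cases hgf : g = f
  · subst hgf
    rw [if_pos rfl, if_pos rfl, ι.arcKindOf_map h₁ h₂ hg hpg]
  · rw [if_neg (fun h => hgf (ι.injF hg hf (Option.some_injective _ h))),
      if_neg (fun h => hgf (Option.some_injective _ h))]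

/-- **Transport of weights.** [folklore] -/
theorem weight_map (h₁ : K₁.Lawful) (h₂ : K₂.Lawful) (hm : K₁.IsWalk D₁ a z m) :
    K₂.weight (m.map ι.φE) = K₁.weight m := by
  unfold weight
  rw [ι.facesOf_map h₁ h₂ hm, Finset.prod_image fun f hf g hg h => ι.injF (hm.facesOf_subset hf) (hm.facesOf_subset hg) h]
  refine Finset.prod_congr rfl fun f hf => ?_
  rw [ι.angle_eq f (hm.facesOf_subset hf), ι.kindsIn_map h₁ h₂ hm (hm.facesOf_subset hf)]

/-- **Transport of the partition sum**: `G_{φ(D₁)}(φ a, φ z) = G_{D₁}(a, z)`. [folklore] -/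
theorem wsum_eq (h₁ : K₁.Lawful) (h₂ : K₂.Lawful) (hD : D₁.Finite) (a z : E₁) :
    K₂.wsum (ι.φF '' D₁) (ι.φE a) (ι.φE z) = K₁.wsum D₁ a z := by
  classical
  unfold wsum
  rw [ι.walkFinset_eq_image h₁ h₂ hD, Finset.sum_image fun m _ m' _ h => List.map_injective_iff.2 ι.injE h]
  refine Finset.sum_congr rfl fun m hm => ι.weight_map (a := a) (z := z) h₁ h₂ ?_
  exact (K₁.mem_walkFinset (K₁.walkSet_finite h₁ hD _ _)).1 hm

end Emb

/-- The embedding given by the identity maps between two complexes on the same types that agree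
(sides and angles) on the faces of `D`. [folklore] -/
def Emb.ofEqOn (K₁ K₂ : Cx F₁ E₁) (D : Set F₁) (hside : ∀ f ∈ D, ∀ s, K₂.side f s = K₁.side f s)
    (hangle : ∀ f ∈ D, K₂.angle f = K₁.angle f) : Emb K₁ K₂ D where
  φF := id
  φE := id
  injE := Function.injective_id
  injF := Set.injOn_id D
  side_eq := hside
  angle_eq := hangle

/-- Two lawful complexes on the same types that agree on the faces of a finite domain have the same
partition sums there. [folklore] -/
theorem wsum_eq_of_eqOn {K₁ K₂ : Cx F₁ E₁} (h₁ : K₁.Lawful) (h₂ : K₂.Lawful) {D : Set F₁} (hD : D.Finite)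
    (hside : ∀ f ∈ D, ∀ s, K₂.side f s = K₁.side f s) (hangle : ∀ f ∈ D, K₂.angle f = K₁.angle f)
    [DecidableEq F₁] (a z : E₁) : K₂.wsum D a z = K₁.wsum D a z := by
  have := (Emb.ofEqOn K₁ K₂ D hside hangle).wsum_eq h₁ h₂ hD a z
  simpa [Emb.ofEqOn, List.map_id'] using this

/-- **Re-labelling the edges** of a complex along a bijection. [folklore] -/
def relabel (K : Cx F₁ E₁) (σ : E₁ ≃ E₂) : Cx F₁ E₂ where
  side f s := σ (K.side f s)
  sideOf f e := K.sideOf f (σ.symm e)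
  commonFace e e' := K.commonFace (σ.symm e) (σ.symm e')
  angle := K.angle

/-- A re-labelled lawful complex is lawful. [folklore] -/
theorem relabel_lawful {K : Cx F₁ E₁} (hK : K.Lawful) (σ : E₁ ≃ E₂) : (K.relabel σ).Lawful where
  sideOf_eq_some_iff f e s := by
    rw [relabel, hK.sideOf_eq_some_iff, Equiv.eq_symm_apply]
  commonFace_eq_some_iff e e' f := by
    rw [relabel]
    simp only [hK.commonFace_eq_some_iff, ne_eq, Equiv.apply_symm_apply, Equiv.eq_symm_apply]

/-- The re-labelling as an embedding (identity on faces). [folklore] -/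
def Emb.relabel (K : Cx F₁ E₁) (σ : E₁ ≃ E₂) (D : Set F₁) : Emb K (K.relabel σ) D where
  φF := id
  φE := σ
  injE := σ.injective
  injF := Set.injOn_id D
  side_eq _ _ _ := rfl
  angle_eq _ _ := rfl

/-- **Re-labelling the edges preserves the partition sums.** [folklore] -/
theorem wsum_relabel {K : Cx F₁ E₁} (hK : K.Lawful) (σ : E₁ ≃ E₂) {D : Set F₁} (hD : D.Finite)
    [DecidableEq F₁] (a z : E₁) : (K.relabel σ).wsum D (σ a) (σ z) = K.wsum D a z := by
  have := (Emb.relabel K σ D).wsum_eq hK (relabel_lawful hK σ) hD a z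
  simpa [Emb.relabel] using this

end Emb

/-! ### The local data of the gluing argument (Corollary 3.2) -/

section Local

variable {F E : Type*} (K : Cx F E)

/-- The **inside runs** of a family: for the gaps `P = [(x₁,y₁), …, (x_k,y_k)]` (pairs of boundary
edges of `H` to be joined inside `H`, in the order and direction the walk traverses them) and the
interior edge-lists `κ = [b₁, …, b_k]`, the edge lists `x_l :: b_l ++ [y_l]` of the pieces of walk
inside `H` ("`γ_1, …, γ_k ⊂ H`, `γ_i : x_i → y_i`"). [cite: GlazmanManolescu2019, Proposition 3.1] -/
def insideRuns (P : List (E × E)) (κ : List (List E)) : List (List E) :=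
  List.zipWith (fun xy b => xy.1 :: (b ++ [xy.2])) P κ

/-- All the arcs of the inside runs, in order. [cite: GlazmanManolescu2019, Proposition 3.1] -/
def insidePairs (P : List (E × E)) (κ : List (List E)) : List (E × E) :=
  (insideRuns P κ).flatMap pairsOf

/-- **Locally admissible families** `κ` of interior edge-lists for the gaps `P` in the sub-complex
`H` (interior edges `IntH`): the clauses of `Cx.IsWalk` that concern the faces of `H` only — every
inside run is a chain of arcs drawn in faces of `H`, the interior edges are used at most once
overall, and no face of `H` carries the two crossing straight arcs ("a collection of self-avoiding
walks such that all rhombi intersected by `γ_1 ∪ ⋯ ∪ γ_n` are in one of the settings of Fig. 1").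
[cite: GlazmanManolescu2019, §3, Proposition 3.1] -/
structure LocValid (H : Finset F) (IntH : Finset E) (P : List (E × E)) (κ : List (List E)) : Prop where
  /-- one interior list per gap -/
  length_eq : κ.length = P.length
  /-- the inserted edges are interior edges of `H` -/
  subset : ∀ b ∈ κ, ∀ e ∈ b, e ∈ IntH
  /-- interior edges are crossed at most once overall -/
  nodup : κ.flatten.Nodup
  /-- every inside arc is drawn in a face of `H` -/
  arc_mem : ∀ p ∈ insidePairs P κ, ∃ f ∈ H, K.arcFace p = some f
  /-- consecutive inside arcs lie in different faces -/
  isChain : ∀ r ∈ insideRuns P κ, (pairsOf r).IsChain fun p q => K.arcFace p ≠ K.arcFace q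
  /-- no face of `H` carries both straight arcs -/
  noncross : ∀ f ∈ H,
    ((K.side f .W, K.side f .E) ∈ insidePairs P κ ∨ (K.side f .E, K.side f .W) ∈ insidePairs P κ) →
      ¬((K.side f .S, K.side f .N) ∈ insidePairs P κ ∨ (K.side f .N, K.side f .S) ∈ insidePairs P κ)

/-- The set of locally admissible families. [cite: GlazmanManolescu2019, Proposition 3.1] -/
def locSolSet (H : Finset F) (IntH : Finset E) (P : List (E × E)) : Set (List (List E)) :=
  {κ | K.LocValid H IntH P κ}

/-- The locally admissible families form a finite set. [folklore] -/
theorem locSolSet_finite (H : Finset F) (IntH : Finset E) (P : List (E × E)) :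
    (K.locSolSet H IntH P).Finite := by
  have hB : {b : List E | b.Nodup ∧ ∀ e ∈ b, e ∈ (↑IntH : Set E)}.Finite :=
    finite_setOf_nodup_of_finite IntH.finite_toSet
  refine (finite_setOf_length_le_of_finite hB P.length).subset fun κ hκ => ⟨hκ.length_eq.le, fun b hb => ?_⟩
  exact ⟨(List.nodup_flatten.1 hκ.nodup).1 b hb, hκ.subset b hb⟩

/-- The locally admissible families as a finite set. [cite: GlazmanManolescu2019, Proposition 3.1] -/
def locSol (H : Finset F) (IntH : Finset E) (P : List (E × E)) : Finset (List (List E)) :=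
  (K.locSolSet_finite H IntH P).toFinset

/-- Membership in `locSol`. [folklore] -/
theorem mem_locSol {H : Finset F} {IntH : Finset E} {P : List (E × E)} {κ : List (List E)} :
    κ ∈ K.locSol H IntH P ↔ K.LocValid H IntH P κ := by
  rw [locSol, Set.Finite.mem_toFinset]; rfl

variable [DecidableEq F]

/-- The kinds of the inside arcs in the face `f`, in order. [cite: GlazmanManolescu2019, Proposition 3.1] -/
def kindsLoc (P : List (E × E)) (κ : List (List E)) (f : F) : List ArcKind :=
  (insidePairs P κ).filterMap fun p => if K.arcFace p = some f then K.arcKindOf p else none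

/-- **The weight of a family inside `H`**: the product over the faces of `H` of their local weights
("define the weight of the family as the product of the weights of each rhombus").
[cite: GlazmanManolescu2019, §3, Proposition 3.1] -/
def wLoc (H : Finset F) (P : List (E × E)) (κ : List (List E)) : ℝ :=
  ∏ f ∈ H, localWeight (K.angle f) (K.kindsLoc P κ f)

/-- **The local partition function `Z_H(P)`**: the total weight of the families of disjoint walks
inside `H` joining the pairs of boundary points `P` — either side of the Yang–Baxter equation
"`Σ_{γ_1,…,γ_k ⊂ H, γ_i : x_i → y_i} w_H(γ_1 ∪ ⋯ ∪ γ_k)`". [cite: GlazmanManolescu2019, Proposition 3.1] -/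
def Zloc (H : Finset F) (IntH : Finset E) (P : List (E × E)) : ℝ :=
  ∑ κ ∈ K.locSol H IntH P, K.wLoc H P κ

end Local

end Cx

/-! ### The grid as a lawful complex; its walks are the `YBWalk`s -/

/-- **The half-plane grid `H(Θ)` of `YangBaxterSAW.lean` as a rhombic complex** (all of `ℤ × ℤ`;
domains are chosen separately). [cite: GlazmanManolescu2019, §1] -/
def gridCx (Θ : ℤ → ℝ) : Cx Face MidEdge where
  side := Face.side
  sideOf := Face.sideOf
  commonFace := MidEdge.commonFace
  angle f := Θ f.1

namespace MidEdge

/-- Two distinct mid-edges of the grid border at most one common face. [folklore] -/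
theorem faces_eq_of_two_common {e e' : MidEdge} {f g : Face} (hfg : f ≠ g)
    (hf : f = e.faces.1 ∨ f = e.faces.2) (hf' : f = e'.faces.1 ∨ f = e'.faces.2)
    (hg : g = e.faces.1 ∨ g = e.faces.2) (hg' : g = e'.faces.1 ∨ g = e'.faces.2) : e = e' := by
  obtain ⟨f1, f2⟩ := f
  obtain ⟨g1, g2⟩ := g
  have hfg' : f1 ≠ g1 ∨ f2 ≠ g2 := by
    by_contra h
    push Not at h
    exact hfg (Prod.ext h.1 h.2)
  cases e with
  | vert k j =>
    cases e' with
    | vert k' j' =>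
      simp only [faces, Prod.mk.injEq] at hf hf' hg hg'
      congr 1 <;> omega
    | slant k' j' =>
      simp only [faces, Prod.mk.injEq] at hf hf' hg hg'
      exfalso; omega
  | slant k j =>
    cases e' with
    | vert k' j' =>
      simp only [faces, Prod.mk.injEq] at hf hf' hg hg'
      exfalso; omega
    | slant k' j' =>
      simp only [faces, Prod.mk.injEq] at hf hf' hg hg'
      congr 1 <;> omega

/-- `commonFace` of the grid is lawful: `commonFace e e' = some f` iff `e ≠ e'` are two sides of
`f`. [folklore] -/
theorem commonFace_eq_some_iff (e e' : MidEdge) (f : Face) :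
    commonFace e e' = some f ↔ e ≠ e' ∧ (∃ s, f.side s = e) ∧ ∃ t, f.side t = e' := by
  rw [Face.exists_side_eq_iff, Face.exists_side_eq_iff]
  constructor
  · exact commonFace_eq_some
  · rintro ⟨hne, hf, hf'⟩
    obtain ⟨g, hg, hge, hge'⟩ := commonFace_isSome hne hf hf'
    rw [hg]
    by_contra hfg
    have hfg : f ≠ g := fun h => hfg (by rw [h])
    exact hne (faces_eq_of_two_common hfg hf hf' hge hge')

end MidEdge

/-- The grid complex is lawful. [folklore] -/
theorem gridCx_lawful (Θ : ℤ → ℝ) : (gridCx Θ).Lawful where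
  sideOf_eq_some_iff := Face.sideOf_eq_some_iff
  commonFace_eq_some_iff := MidEdge.commonFace_eq_some_iff

namespace YBWalk

variable {D : Set Face} {a z : MidEdge}

/-- The edge list of a `YBWalk` is a walk of the grid complex. [cite: GlazmanManolescu2019, §1] -/
theorem isWalk_mids (Θ : ℤ → ℝ) (γ : YBWalk D a z) : (gridCx Θ).IsWalk D a z γ.mids :=
  ⟨γ.head_eq, γ.getLast_eq, γ.nodup, γ.arc_mem, γ.isChain, γ.noncross⟩

/-- A walk of the grid complex as a `YBWalk`. [cite: GlazmanManolescu2019, §1] -/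
def ofIsWalk {Θ : ℤ → ℝ} {m : List MidEdge} (h : (gridCx Θ).IsWalk D a z m) : YBWalk D a z :=
  ⟨m, h.head_eq, h.getLast_eq, h.nodup, h.arc_mem, h.isChain, h.noncross⟩

/-- `ofIsWalk` has the given edge list. [folklore] -/
@[simp] theorem mids_ofIsWalk {Θ : ℤ → ℝ} {m : List MidEdge} (h : (gridCx Θ).IsWalk D a z m) :
    (ofIsWalk h).mids = m := rfl

/-- The weight of a `YBWalk` is the weight of its edge list in the grid complex.
[cite: GlazmanManolescu2019, §1] -/
theorem weight_gridCx (Θ : ℤ → ℝ) (γ : YBWalk D a z) : (gridCx Θ).weight γ.mids = γ.weight Θ := rfl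

end YBWalk

/-- The walks of the grid complex are the edge lists of the `YBWalk`s. [cite: GlazmanManolescu2019, §1] -/
theorem walkSet_gridCx (Θ : ℤ → ℝ) (D : Set Face) (a z : MidEdge) :
    (gridCx Θ).walkSet D a z = Set.range (YBWalk.mids : YBWalk D a z → List MidEdge) :=
  Set.ext fun _ => ⟨fun h => ⟨YBWalk.ofIsWalk h, rfl⟩, fun ⟨γ, hγ⟩ => hγ ▸ γ.isWalk_mids Θ⟩

/-- For a finite domain, the partition sum of the grid complex is the sum of the weights of the
`YBWalk`s. [cite: GlazmanManolescu2019, §1] -/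
theorem wsum_gridCx {D : Set Face} (hD : D.Finite) (Θ : ℤ → ℝ) (a z : MidEdge) [Fintype (YBWalk D a z)] :
    (gridCx Θ).wsum D a z = ∑ γ : YBWalk D a z, γ.weight Θ := by
  have hfin := (gridCx Θ).walkSet_finite (gridCx_lawful Θ) hD a z
  have hinj : Function.Injective (YBWalk.mids : YBWalk D a z → List MidEdge) := fun γ γ' h => YBWalk.ext h
  have hset : (gridCx Θ).walkFinset D a z = Finset.univ.map ⟨YBWalk.mids, hinj⟩ := by
    ext m
    rw [(gridCx Θ).mem_walkFinset hfin, Finset.mem_map]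
    exact ⟨fun h => ⟨YBWalk.ofIsWalk h, Finset.mem_univ _, rfl⟩, fun ⟨γ, _, hγ⟩ => hγ ▸ γ.isWalk_mids Θ⟩
  rw [Cx.wsum, hset, Finset.sum_map]
  rfl

/-- **`G_D = ofReal (Σ w)`**: for a finite domain and angles in `[π/3, 2π/3]` (non-negative weights)
the `ℝ≥0∞`-valued two-point function of `YangBaxterSAW.lean` is the real partition sum of the grid
complex. [cite: GlazmanManolescu2019, §1 and §4.2] -/
theorem twoPoint_eq_ofReal_wsum {D : Set Face} (hD : D.Finite) {Θ : ℤ → ℝ}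
    (hΘ : ∀ k, Θ k ∈ Set.Icc (π / 3) (2 * π / 3)) (a z : MidEdge) :
    twoPoint D Θ a z = ENNReal.ofReal ((gridCx Θ).wsum D a z) := by
  haveI : Finite D := hD.to_subtype
  haveI : Fintype (YBWalk D a z) := Fintype.ofFinite _
  rw [twoPoint, tsum_fintype, wsum_gridCx hD, ENNReal.ofReal_sum_of_nonneg fun γ _ => γ.weight_nonneg hΘ]

/-- The real partition sum of the grid is non-negative for angles in `[π/3, 2π/3]`.
[cite: GlazmanManolescu2019, §1 ("the weights above are all non-negative")] -/
theorem wsum_gridCx_nonneg {D : Set Face} (hD : D.Finite) {Θ : ℤ → ℝ}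
    (hΘ : ∀ k, Θ k ∈ Set.Icc (π / 3) (2 * π / 3)) (a z : MidEdge) : 0 ≤ (gridCx Θ).wsum D a z := by
  haveI : Finite D := hD.to_subtype
  haveI : Fintype (YBWalk D a z) := Fintype.ofFinite _
  rw [wsum_gridCx hD]
  exact Finset.sum_nonneg fun γ _ => γ.weight_nonneg hΘ

end Literature.Probability.RandomPlanarGeometry.SAW.YangBaxter
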